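import Mathlib.Analysis.SpecialFunctions.BinaryEntropy
import Literature.NumberTheory.DiophantineGeometry.GenEllFermatReduction
import Summits.ABC.FunctionField.TransferSheetBMY
import Summits.ABC.FunctionField.TransferSheetLadder
import Summits.ABC.FunctionField.TransferSheetSixFifths
import HarnessLib

/-!
# Cell abc-ff — transfer sheet, chain (d) NEVANLINNA / VOJTA: the fixed-`e` Fermat–Vojta rung
# (row CF-7b, kernel skeleton) and the SIZE axis of the derivative surrogates (row D-11)

`Summits/ABC/FunctionField/TransferSheetNevanlinna.lean` (cell abc-ff; mathematics and Lean by the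
cell's NEVANLINNA lens seat abc-ff-lens-5, `HOME/lens-5/Sketch_NV.lean` sha16 `89eba5e9b8202055` +
`NV-STEPS.md` §§3–4, farm rc 0, graded by referee B in `HOME/ref-2/REF-B-v0.8.md` (CF-7b PASS as a
genuine intermediate rung; CF-7a/c/d/e AGREE); re-pointed to the tree decls and landed by the typer
seat). HONESTY: abc is not proved by any of this. Every open statement below (`GenEll.VojtaFermat`,
`GenEll.ABCWithExponent`, `PolyAbcWith`) is used only as a HYPOTHESIS or reached only as a CONCLUSION
of an implication (D-0139/D-0140); «NOT abc — POLY-ABC(M), M stated» where it says so; typed ≠ proved;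
a primary is a source, not an endorsement; nothing here bears on [IUTchIII] Cor. 3.12. No new
`@[conjecture]` requirement is introduced: every requirement of this chain is CITED BY NAME.

## The chain and its first non-transferring step (rows NV-1…NV-7, D-9…D-12 of the cell's sheet)
The Nevanlinna / Vojta proof of the analytic and of the function-field abc (truncated Second Main
Theorem for three points) has ONE non-formal input, the Lemma on the Logarithmic Derivative (Vojta,
CIME LNM 2009 (2011), Thm 28.1; McQuillan's tautological inequality Thm 28.6); «in the number field
case … there is currently no known counterpart to the derivative» (ibid.). That step (NV-3 = sheet rows
KS-2 / B-2∧B-4 / MS-5: the same `dφ ≠ 0`) is the first non-transferring one; the typed replacements are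
* CF-7a (Wronskian shape) = `Literature.Barriers.ABC.Pasten.SmallDerivativesConjectureWith η` — by
  name; census O-73; window of record in `TransferSheetMason.lean` / `TransferSheetMasonRigid.lean` /
  `TransferSheetWindowHits.lean` (neither A0 nor A-PS: live only for `η ∈ [1/2, 1)` ⇒ POLY-ABC(`M > 2`)).
* **CF-7b (algebroid-SMT shape, THIS FILE §1) = `GenEll.VojtaFermat e (e^3) ε'` for ONE fixed `e ≥ 4`
  and all `ε' > 0`** (Vojta 1987 Ex. 5.5.2 with `(n, A)` kept free = CIME Prop. 25.2 = [GenEll] Thm 2.1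
  Step 1, tree `Literature.NumberTheory.DiophantineGeometry.GenEllFermatReduction`): it gives abc WITH
  EXPONENT `e/(e−3)` (`abcWithExponent_of_vojtaFermat`) hence `PolyAbcWith M` for every `M > e/(e−3)`
  (`polyAbcWith_of_vojtaFermat`) — «NOT abc — POLY-ABC(M > e/(e−3))» (`e = 4`: `M > 4`; `e = 7`:
  `M > 7/4`; `e = 19`: `M > 19/16`). STRENGTH (REF-B v0.8): not a restatement (exponent `≠ 1`; not known
  to follow from abc/ℚ — in print it follows from UNIFORM abc in degree `≤ e³`, van Frankenhuijsen);
  PATH: the `e`-ladder, whose envelope `∀ e` IS the summit by tree theorems (`abc_of_vojtaFermat_all`,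
  restatement-at-the-envelope); the A-PS reach «POLY-ABC(M < 6/5) ⟹ POLY-SZPIRO(6M/(6−5M))» needs
  `e/(e−3) < 6/5`, i.e. EXACTLY `e ≥ 19` (`vojtaFermat_exponent_lt_six_fifths_iff`), with Szpiro
  exponent `6e/(e−18)` (`vojtaFermat_szpiro_exponent`; `e = 19 ↦ 114`) — composed BY NAME in §3
  (`polySzpiroWith_of_vojtaFermat`, `polySzpiroRat_of_vojtaFermat`) with the fixed-`M`
  Oesterlé–Silverman elimination `polySzpiroWith_of_abcWithExponent` of `TransferSheetSixFifths.lean`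
  (referee B's certificate `HOME/ref-2/RefB_SixFifths.lean`, landed by the abc-an cell; not restated
  here) — rung A-PS «NOT abc — POLY-SZPIRO(E)». EFFECTIVE: iff the hypothesis' constant is (the skeleton's own
  constants are explicit). BARRIERS: `ε'` kept and the log-different enters with coefficient `1 + ε'`
  plus an additive constant (`EpsilonCannotBeDropped`, `UniformABCDiscriminantSharp` respected);
  `BakerMethodBounds`, `NoArithmeticDerivative` not in play. CHEAPEST FALSIFIER: none finite off the
  abc quality table (REF-B calibration: generic degree-`m` points sit at ratio `≈ (e−3)/(2m−2)`).
* CF-7c = `GenEll.VojtaP1Deg 1 ⟺ ABC` (`GenEll.vojtaP1Deg_one_iff_abc`) — RESTATEMENT, dictionary endpoint.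
* CF-7d (Buium's `δ_p` as the log-derivative lemma) = NONE, with the kernel reason of §2
  (`Buium.sq_le_pDerivNum_div`: the `p`-derivation at least DOUBLES the height, `η ≥ 1` identically,
  against the needed `η < 1`); CF-7e (van Frankenhuijsen's completed radical) = a reading, restatement
  family (sub-`√h` error terms excluded by `EpsilonCannotBeDropped`).

## §2 Row D-11: the SIZE axis (L3) of the integer surrogates for `d/dt` (namespaces `Buium`, `MulLog`)
For Buium's `p`-derivation `δ_p a = (a − a^p)/p` (Buium, *Arithmetic differential equations*, 2005;
Found. Arith. Diff. Geom., 2017, §1.2.1) we record on the numerator `N_p a := a − a^p = p · δ_p a` (no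
integer division): twisted Leibniz, the additivity defect (carry polynomial), the `δ_p`-Wronskian
identity with Fermat quotients, and the SIZE FAILURE `a² ≤ |δ_p a|` (`a ≥ 2`, `p ≥ 5`). For the
archimedean weight `D(n) = n log n`: Leibniz exact, additivity defect on `a + b = c` = the entropy
`c · h₂(a/c) ≤ c log 2` (Mathlib `Real.binEntropy`) — L3 holds, L2 nearly, but integrality (hence the
divisibility / truncation step MS-6) is lost. Pasten's integer `d^ψ` is the tree's
`Literature.Barriers.ABC.arithDerivWith` (row c-1, not restated); Barbeau's `D` is
`Literature.Barriers.ABC.arithDeriv` (not additive on the equation). Placement w.r.t.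
`Literature.Barriers.ABC.IntegersHaveNoDerivation(Narrow)`: all four candidates are OUTSIDE the barrier's
class (only globally additive Leibniz maps are inside); what kills them is size or integrality.

Deliberately NOT here: any restatement of `ABC`, of Pasten's conjecture or of `GenEll.VojtaFermat`; the
fixed-`M` elimination itself (sibling file `TransferSheetSixFifths.lean`, used by name in §3); lens-5's
card NV-C1 (an idea, not a row).
-/

noncomputable section

open Literature.NumberTheory.DiophantineGeometry
open Literature.NumberTheory.DiophantineGeometry.GenEll
open Polynomial NumberField

namespace Summit.ABC.FunctionField

/-! ## §1 Row CF-7b: fixed-`e` Fermat–Vojta ⟹ abc with exponent `e/(e−3)` ⟹ POLY-ABC(M), `M > e/(e−3)` -/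

/-- **Fixed-`e` form of [GenEll] Thm 2.1 Step 1 / Vojta 1987 Ex. 5.5.2 (PROVED, lens-5).** For ONE
`e ≥ 4`: `GenEll.VojtaFermat e (e³·d) ε'` (Vojta's inequality `(e−3)·ht ≤ (1+ε')·log-diff + C` for the
points of the Fermat curve `F_e` presented over number fields of degree `≤ e³ d`) implies Vojta's
inequality on `ℙ¹ ∖ {0,1,∞}` in degree `≤ d` with HEIGHT COEFFICIENT `Λ = e/(e−3)`:
`ht ≲ (e/(e−3))·(1+ε')·(log-diff + log-cond)` (`GenEll.VojtaIneqWith Set.univ d (e/(e−3)) ε'`). Same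
proof as the tree's envelope theorem `GenEll.vojtaP1Deg_of_vojtaFermat` with `e` frozen: Kummer
covering `u^e = x`, `w^e = 1 − x`; different bound `GenEll.logdisc_le_of_isSplittingField_kummer`;
`(1/e)·ht(x) ≤ ht(u : w : 1)` (`GenEll.P1Point.ht_le_fermat_ht`). (Vojta's own bookkeeping, CIME 2011
proof of Prop. 25.2, gives the slightly better `(e−1)/(e−3)`; the kernel value is the weaker, safe one.)
[cite: Vojta1987, Ex. 5.5.2] -/
theorem vojtaIneqWith_of_vojtaFermat {e : ℕ} (he : 4 ≤ e) {d : ℕ} {ε' : ℝ} (hε' : 0 < ε')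
    (h : VojtaFermat e (e ^ 3 * d) ε') :
    VojtaIneqWith Set.univ d ((e : ℝ) / ((e : ℝ) - 3)) ε' := by
  have hepos : 0 < e := by omega
  have heR : (3 : ℝ) < e := by exact_mod_cast (show 3 < e by omega)
  obtain ⟨C₀, hC⟩ := h
  -- the constant of the Kummer different bound, uniform in the point
  set c : ℝ := Real.log e + Real.log ((e : ℝ) ^ 3) + Real.log (e ^ 3).factorial with hc_def
  rw [vojtaIneqWith_iff_bdLe]
  refine ⟨(e : ℝ) / ((e : ℝ) - 3) * ((1 + ε') * c + C₀), fun P hP => ?_⟩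
  obtain ⟨-, hPle⟩ := hP
  have hPU : P.InU := hPle.1.1
  have hPd : P.degree ≤ d := hPle.2
  -- the splitting field and the Fermat point over it
  let N : Type := ((X ^ e - 1) * ((X ^ e - C P.x) * (X ^ e - C (1 - P.x))) : P.F[X]).SplittingField
  haveI : NumberField N := NumberField.of_module_finite P.F N
  obtain ⟨⟨u, hu⟩, ⟨w, hw⟩⟩ := GenEll.exists_pow_eq N P.x hepos
  have hrel : u ^ e + w ^ e = 1 := by rw [hu, hw, ← map_add, add_sub_cancel, map_one]
  let Q : FermatPoint e := ⟨N, u, w, hrel⟩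
  have hQdeg : Q.degree ≤ e ^ 3 * d := by
    change Module.finrank ℚ N ≤ e ^ 3 * d
    rw [← Module.finrank_mul_finrank ℚ P.F N, mul_comm]
    exact Nat.mul_le_mul (finrank_le_of_isSplittingField_kummer P N hPU hepos) hPd
  have hV := hC Q hQdeg
  -- the two comparisons
  have hht : (e : ℝ)⁻¹ * P.ht ≤ Q.ht := P.ht_le_fermat_ht N hepos (w := w) hu
  have hdisc : Q.logDiff ≤ P.logDiff + P.logCond + c := by
    have h0 := logdisc_le_of_isSplittingField_kummer P N hPU hepos
    have hn := finrank_le_of_isSplittingField_kummer P N hPU hepos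
    have hn1 : 1 ≤ Module.finrank P.F N := Module.finrank_pos
    have hlogn : Real.log (Module.finrank P.F N) ≤ Real.log ((e : ℝ) ^ 3) :=
      Real.log_le_log (by exact_mod_cast hn1) (by exact_mod_cast hn)
    have hlogf : Real.log (Module.finrank P.F N).factorial ≤ Real.log (e ^ 3).factorial :=
      Real.log_le_log (by exact_mod_cast Nat.factorial_pos _)
        (by exact_mod_cast Nat.factorial_le hn)
    change (Module.finrank ℚ N : ℝ)⁻¹ * Real.log ((discr N).natAbs : ℝ) ≤ _
    rw [hc_def]
    linarith
  -- assemble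
  have h3e : 0 < (e : ℝ) - 3 := by linarith
  have heR0 : (0 : ℝ) < e := by exact_mod_cast hepos
  have h5 : ((e : ℝ) - 3) * ((e : ℝ)⁻¹ * P.ht) ≤ (1 + ε') * (P.logDiff + P.logCond + c) + C₀ := by
    calc ((e : ℝ) - 3) * ((e : ℝ)⁻¹ * P.ht) ≤ ((e : ℝ) - 3) * Q.ht :=
          mul_le_mul_of_nonneg_left hht h3e.le
      _ ≤ (1 + ε') * Q.logDiff + C₀ := hV
      _ ≤ (1 + ε') * (P.logDiff + P.logCond + c) + C₀ := by
          have : 0 ≤ 1 + ε' := by linarith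
          nlinarith
  have h6 : P.ht ≤ (e : ℝ) / ((e : ℝ) - 3) * ((1 + ε') * (P.logDiff + P.logCond + c) + C₀) := by
    have hlhs : ((e : ℝ) - 3) * ((e : ℝ)⁻¹ * P.ht) = P.ht / ((e : ℝ) / ((e : ℝ) - 3)) := by
      field_simp
    rw [hlhs, div_le_iff₀ (by positivity)] at h5
    linarith [h5]
  have h7 : (e : ℝ) / ((e : ℝ) - 3) * ((1 + ε') * (P.logDiff + P.logCond + c) + C₀) =
      (e : ℝ) / ((e : ℝ) - 3) * ((1 + ε') * (P.logDiff + P.logCond)) +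
        (e : ℝ) / ((e : ℝ) - 3) * ((1 + ε') * c + C₀) := by ring
  rw [h7] at h6
  show P.ht - (e : ℝ) / ((e : ℝ) - 3) * ((1 + ε') * (P.logDiff + P.logCond)) ≤ _
  linarith

/-- Fixed-`e` Fermat–Vojta in all degrees `e³·d` (every `ε' > 0`) ⟹ `GenEll.VojtaP1DegWith d (e/(e−3))`,
the CF-6 consequence currency of `TransferSheetBMY.lean` at loss `Λ = e/(e−3)` in degree `d`
(PROVED, lens-5). [folklore] -/
theorem vojtaP1DegWith_of_vojtaFermat {e : ℕ} (he : 4 ≤ e) {d : ℕ}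
    (h : ∀ ε' : ℝ, 0 < ε' → VojtaFermat e (e ^ 3 * d) ε') :
    VojtaP1DegWith d ((e : ℝ) / ((e : ℝ) - 3)) :=
  fun ε hε => vojtaIneqWith_of_vojtaFermat he hε (h ε hε)

/-- **Row CF-7b skeleton, step 1 (PROVED, lens-5):** Vojta's weak conjecture on the ONE Fermat curve
`F_e` (`e ≥ 4`) for its points of degree `≤ e³` gives **abc with exponent `e/(e−3)`**
(`GenEll.ABCWithExponent`, via the tree's `GenEll.abcExp_of_vojtaIneqWith_one`): only rational
`x = a/c` (degree `d = 1`) are needed. «NOT abc» for fixed `e` (exponent `e/(e−3) > 1`).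
[cite: Vojta1987, Ex. 5.5.2] -/
theorem abcWithExponent_of_vojtaFermat {e : ℕ} (he : 4 ≤ e)
    (h : ∀ ε' : ℝ, 0 < ε' → VojtaFermat e (e ^ 3) ε') :
    ABCWithExponent ((e : ℝ) / ((e : ℝ) - 3)) :=
  abcExp_of_vojtaIneqWith_one fun ε hε =>
    vojtaIneqWith_of_vojtaFermat he hε (d := 1) (by rw [mul_one]; exact h ε hε)

/-- The CF-7b exponent is positive: `0 < e/(e−3)` for `e ≥ 4`. [folklore] -/
theorem vojtaFermat_exponent_pos {e : ℕ} (he : 4 ≤ e) : 0 < (e : ℝ) / ((e : ℝ) - 3) := by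
  have heR : (3 : ℝ) < e := by exact_mod_cast (show 3 < e by omega)
  exact div_pos (by linarith) (by linarith)

/-- **Row CF-7b skeleton in the sheet's currency (PROVED, lens-5): fixed-`e` Fermat–Vojta ⟹
`PolyAbcWith M` for every `M > e/(e−3)`** (through the sheet bridge
`polyAbcWith_of_abcWithExponent` of `TransferSheetBMY.lean`). «NOT abc — POLY-ABC(M), M stated»
(`e = 4`: `M > 4`; `e = 19`: `M > 19/16 < 6/5`, the threshold below which POLY-abc(M) ⟹ POLY-SZPIRO,
`vojtaFermat_exponent_lt_six_fifths_iff`); ineffective iff the hypothesis is. The hypothesis for ALL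
`e ≥ 4` is the summit (`abc_of_vojtaFermat_all`). [folklore] -/
theorem polyAbcWith_of_vojtaFermat {e : ℕ} (he : 4 ≤ e)
    (h : ∀ ε' : ℝ, 0 < ε' → VojtaFermat e (e ^ 3) ε') {M : ℝ}
    (hM : (e : ℝ) / ((e : ℝ) - 3) < M) : PolyAbcWith M :=
  polyAbcWith_of_abcWithExponent (vojtaFermat_exponent_pos he)
    (abcWithExponent_of_vojtaFermat he h) hM

/-- **The A-PS threshold of the `e`-ladder (bookkeeping, PROVED): `e/(e−3) < 6/5 ⟺ e > 18`** (`e ≥ 4`).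
POLY-ABC(M) is known to give POLY-SZPIRO only for `M < 6/5` (Oesterlé 1988 §2 / Silverman AEC
VIII.11.5(b) elimination via the minimal `2`-isogenous model); so CF-7b reaches rung A-PS «NOT abc —
POLY-SZPIRO(E)» exactly from `e = 19` on — ON PAPER in this file (the fixed-`M` elimination is referee
B's certificate `RefB_SixFifths.lean`, landed separately as `TransferSheetSixFifths.lean` and to be
composed by name). [folklore] -/
theorem vojtaFermat_exponent_lt_six_fifths_iff {e : ℕ} (he : 4 ≤ e) :
    (e : ℝ) / ((e : ℝ) - 3) < 6 / 5 ↔ 18 < e := by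
  have heR : (3 : ℝ) < e := by exact_mod_cast (show 3 < e by omega)
  have h3e : 0 < (e : ℝ) - 3 := by linarith
  rw [div_lt_iff₀ h3e]
  constructor
  · intro h
    have h18 : (18 : ℝ) < e := by linarith
    exact_mod_cast h18
  · intro h
    have h18 : (18 : ℝ) < e := by exact_mod_cast h
    linarith

/-- **Szpiro-exponent bookkeeping of the `e`-ladder (PROVED, over `ℝ`):** the fixed-`M` elimination
`POLY-ABC(M) ⟹ POLY-SZPIRO(6M/(6−5M))` evaluated at the CF-7b exponent `M = e/(e−3)` gives
`6e/(e−18)` (`e = 19 ↦ 114`, `e = 24 ↦ 24`, `e → ∞ ↦ 6⁺`, never `6`: `SzpiroEpsilonCannotBeDropped`).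
Pure algebra (`e ≠ 3`, `e ≠ 18`), for referee A's exponent re-derivation. [folklore] -/
theorem vojtaFermat_szpiro_exponent {e : ℝ} (he3 : e ≠ 3) (he18 : e ≠ 18) :
    6 * (e / (e - 3)) / (6 - 5 * (e / (e - 3))) = 6 * e / (e - 18) := by
  have h3 : e - 3 ≠ 0 := sub_ne_zero.mpr he3
  have h18 : e - 18 ≠ 0 := sub_ne_zero.mpr he18
  have h6 : 6 - 5 * (e / (e - 3)) = (e - 18) / (e - 3) := by
    field_simp
    ring
  rw [h6]
  field_simp

/-- **Regression / A0 endpoint (PROVED, tree theorems only):** Fermat–Vojta for EVERY `e ≥ 4`, every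
degree and every `ε' > 0` is abc-strength — it gives the summit sentence `ABC`
(`GenEll.vojtaP1Deg_of_vojtaFermat`, `GenEll.abc_of_vojtaP1Deg`, `ABC_iff`). This is Vojta 1987
App. ABC / CIME Prop. 25.2 «weak Vojta on the Fermat curves ⟹ abc», RESTATEMENT class at the envelope
of the `e`-ladder; abc is NOT proved by this. [cite: Vojta1987, Appendix ABC] -/
theorem abc_of_vojtaFermat_all
    (h : ∀ e : ℕ, 4 ≤ e → ∀ d' : ℕ, ∀ ε' : ℝ, 0 < ε' → VojtaFermat e d' ε') : _root_.ABC :=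
  ABC_iff.mpr (abc_of_vojtaP1Deg fun d _ => vojtaP1Deg_of_vojtaFermat h d)

/-! ## §2 Row D-11: the SIZE axis of the derivative surrogates -/

namespace Buium

/-- Numerator of Buium's `p`-derivation: `N_p a := a − a^p = p · δ_p a` (`δ_p a = (a − a^p)/p`,
Buium 2005 / 2017 §1.2.1; for `p` prime `p ∣ a − a^p` by Fermat). Working with `N_p` keeps every
identity polynomial over `ℤ`. (Lens-5, row D-11; a bookkeeping definition, not a requirement.)
[cite: Buium2015, §1.2.1] -/
def pDerivNum (p : ℕ) (a : ℤ) : ℤ := a - a ^ p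

/-- Twisted Leibniz rule `δ(ab) = a^p δb + b^p δa + p δa δb`, on numerators:
`N(ab) = a^p N(b) + b^p N(a) + N(a) N(b)` («of course, not a derivation», Buium) — so `δ_p` is outside
the class of `Literature.Barriers.ABC.IntegersHaveNoDerivation`. [folklore] -/
theorem pDerivNum_mul (p : ℕ) (a b : ℤ) :
    pDerivNum p (a * b) = a ^ p * pDerivNum p b + b ^ p * pDerivNum p a +
      pDerivNum p a * pDerivNum p b := by
  unfold pDerivNum; ring

/-- Additivity defect `δ(a+b) = δa + δb + C_p(a,b)`, `C_p(a,b) = (a^p + b^p − (a+b)^p)/p`, on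
numerators: `N(a+b) = N(a) + N(b) − ((a+b)^p − a^p − b^p)` — axis L2 (additivity on the one equation
`a + b = c`) FAILS for `δ_p` unless the carry term vanishes. [folklore] -/
theorem pDerivNum_add (p : ℕ) (a b : ℤ) :
    pDerivNum p (a + b) = pDerivNum p a + pDerivNum p b - ((a + b) ^ p - a ^ p - b ^ p) := by
  unfold pDerivNum; ring

/-- The `δ_p`-Wronskian identity: `a·N_p(b) − b·N_p(a) = a·b·(a^{p−1} − b^{p−1})`, i.e.
`a δ_p b − b δ_p a = ab·(q_p(a) − q_p(b))` with the Fermat quotients `q_p(x) = (x^{p−1} − 1)/p`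
(`p ∤ ab`): non-vanishing mod `p` iff `(a/b)^{p−1} ≢ 1 (mod p²)` (a Wieferich-type condition) — there IS
a Wronskian (axis L4 can hold), but see `sq_le_pDerivNum_div` for why it cannot play the log-derivative
lemma. [folklore] -/
theorem wronskian_pDerivNum {p : ℕ} (hp : 1 ≤ p) (a b : ℤ) :
    a * pDerivNum p b - b * pDerivNum p a = a * b * (a ^ (p - 1) - b ^ (p - 1)) := by
  obtain ⟨k, rfl⟩ : ∃ k, p = k + 1 := ⟨p - 1, by omega⟩
  simp only [pDerivNum, Nat.add_sub_cancel]
  ring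

/-- `n + 3 ≤ 2^n` for `n ≥ 3` (auxiliary). [folklore] -/
private theorem add_three_le_two_pow {n : ℕ} (hn : 3 ≤ n) : n + 3 ≤ 2 ^ n := by
  induction n, hn using Nat.le_induction with
  | base => norm_num
  | succ k hk ih => rw [pow_succ]; omega

/-- **Size failure of the `p`-derivation as a log-derivative surrogate (axis L3 ✗, PROVED, lens-5):**
for `a ≥ 2` and `p ≥ 5`, `p·a² + a ≤ a^p`, i.e. `a² ≤ (a^p − a)/p = |δ_p a|`: the `p`-derivative at least
DOUBLES the logarithmic height (`h(δ_p a) ≥ 2 h(a)`), against `h(f') ≤ h(f) + O(log h)` (Nevanlinna LDL,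
Vojta CIME Thm 28.1), `deg a' ≤ deg a − 1` (Mason), and Pasten's conjectural `‖ψ‖ < c^η`, `η < 1`
(`Literature.Barriers.ABC.Pasten.SmallDerivativesConjectureWith`). Row CF-7d's kernel reason. [folklore] -/
theorem mul_sq_add_le_pow {a p : ℕ} (ha : 2 ≤ a) (hp : 5 ≤ p) : p * a ^ 2 + a ≤ a ^ p := by
  have h2 : p + 1 ≤ 2 ^ (p - 2) := by
    have := add_three_le_two_pow (n := p - 2) (by omega)
    omega
  have h3 : 2 ^ (p - 2) ≤ a ^ (p - 2) := Nat.pow_le_pow_left ha _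
  have h4 : a ^ p = a ^ 2 * a ^ (p - 2) := by rw [← pow_add]; congr 1; omega
  have h5 : a ≤ a ^ 2 := by nlinarith
  calc p * a ^ 2 + a ≤ p * a ^ 2 + a ^ 2 := by omega
    _ = a ^ 2 * (p + 1) := by ring
    _ ≤ a ^ 2 * a ^ (p - 2) := Nat.mul_le_mul_left _ (h2.trans h3)
    _ = a ^ p := h4.symm

/-- The same in `δ_p`-form over `ℤ`: for `a ≥ 2`, `p ≥ 5`, `a² ≤ (a^p − a)/p = −δ_p a = |δ_p a|`
(integer division; exact when `p` is prime). [folklore] -/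
theorem sq_le_pDerivNum_div {a p : ℕ} (ha : 2 ≤ a) (hp : 5 ≤ p) :
    ((a : ℤ) ^ 2) ≤ (-pDerivNum p a) / p := by
  have h := mul_sq_add_le_pow ha hp
  have hp0 : (0 : ℤ) < p := by exact_mod_cast (show 0 < p by omega)
  rw [Int.le_ediv_iff_mul_le hp0]
  unfold pDerivNum
  have : (p : ℤ) * (a : ℤ) ^ 2 + a ≤ (a : ℤ) ^ p := by exact_mod_cast h
  nlinarith

/-- Sanity (the surrogate of this section is NOT Barbeau's / Pasten's): `N_5 2 = 2 − 32 = −30`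
(`δ_5 2 = −6`), while Barbeau's `D = d^σ` has `D 2 = 1` (`Literature.Barriers.ABC.arithDeriv_two`).
[folklore] -/
theorem pDerivNum_five_two : pDerivNum 5 2 = -30 := by
  norm_num [pDerivNum]

end Buium

namespace MulLog

/-- **The archimedean weight (`ψ(p) = p log p`, `D(n) = n log n`): additivity defect = entropy.** For
`a, b > 0`, `c = a + b`: `c log c − a log a − b log b = c · h₂(a/c)` with `h₂` the binary entropy
(Mathlib `Real.binEntropy`). (Lens-5, row D-11.) [folklore] -/
theorem mulLog_add_sub_eq_binEntropy {a b : ℝ} (ha : 0 < a) (hb : 0 < b) :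
    (a + b) * Real.log (a + b) - a * Real.log a - b * Real.log b =
      (a + b) * Real.binEntropy (a / (a + b)) := by
  have hc : 0 < a + b := by linarith
  have h1 : 1 - a / (a + b) = b / (a + b) := by field_simp; ring
  rw [Real.binEntropy, h1, Real.log_inv, Real.log_inv, Real.log_div ha.ne' hc.ne',
    Real.log_div hb.ne' hc.ne']
  field_simp
  ring

/-- Hence `0 ≤ D(a+b) − D(a) − D(b) ≤ (a+b)·log 2` for `D(n) = n log n`: Leibniz exact (`mulLog_mul`),
additivity up to `c log 2` — the ONLY surrogate in lens-5's table with axis L3 (no height loss: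
`h(D n) = h(n) + log h(n)`) and near-L2, at the price of integrality (no divisibility `abc/rad ∣ W`,
i.e. no truncation step). [Mathlib `Real.binEntropy_le_log_two`, `Real.binEntropy_nonneg`] [folklore] -/
theorem mulLog_add_defect_le {a b : ℝ} (ha : 0 < a) (hb : 0 < b) :
    0 ≤ (a + b) * Real.log (a + b) - a * Real.log a - b * Real.log b ∧
      (a + b) * Real.log (a + b) - a * Real.log a - b * Real.log b ≤ (a + b) * Real.log 2 := by
  have hc : 0 < a + b := by linarith
  rw [mulLog_add_sub_eq_binEntropy ha hb]
  have hp0 : 0 ≤ a / (a + b) := div_nonneg ha.le hc.le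
  have hp1 : a / (a + b) ≤ 1 := by rw [div_le_one hc]; linarith
  exact ⟨mul_nonneg hc.le (Real.binEntropy_nonneg hp0 hp1),
    mul_le_mul_of_nonneg_left Real.binEntropy_le_log_two hc.le⟩

/-- Leibniz is exact for `D(x) = x log x` on positive reals: `D(ab) = a·D(b) + b·D(a)` (compare
Mathlib's `Real.negMulLog_mul` for `−x log x`). [folklore] -/
theorem mulLog_mul {a b : ℝ} (ha : 0 < a) (hb : 0 < b) :
    (a * b) * Real.log (a * b) = a * (b * Real.log b) + b * (a * Real.log a) := by
  rw [Real.log_mul ha.ne' hb.ne']; ring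

end MulLog

/-! ## §3 Row CF-7b reaches rung A-PS in the kernel for `e ≥ 19` (composition BY NAME)

Appended once the fixed-`M` Oesterlé–Silverman elimination landed in the tree as
`TransferSheetSixFifths.lean` (referee B's certificate `RefB_SixFifths.lean` sha16 `1da4f2ba6c01246d`,
landed verbatim by the abc-an cell; decl `polySzpiroWith_of_abcWithExponent`: `1 ≤ Λ < 6/5`,
`ABCWithExponent Λ` ⟹ `PolySzpiroWith E` for every `E > 6Λ/(6−5Λ)`). This closes, in the kernel, the
«A-PS only on paper» flag of REF-B v0.8 for row CF-7b: for ONE `e ≥ 19`, Vojta's weak conjecture on the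
Fermat curve `F_e` for its points of degree `≤ e³` gives POLY-SZPIRO(E) for every `E > 6e/(e−18)`
(`e = 19`: `E > 114`; `e = 24`: `E > 24`; `e → ∞`: `E → 6⁺`) and hence `Summit.ABC.PolySzpiroRat`.
«NOT abc — POLY-SZPIRO(E)»; the hypothesis is OPEN; only the implication is proved. -/

/-- The CF-7b exponent is at least `1`: `1 ≤ e/(e−3)` for `e ≥ 4`. [folklore] -/
theorem one_le_vojtaFermat_exponent {e : ℕ} (he : 4 ≤ e) : 1 ≤ (e : ℝ) / ((e : ℝ) - 3) := by
  have heR : (3 : ℝ) < e := by exact_mod_cast (show 3 < e by omega)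
  rw [le_div_iff₀ (by linarith)]
  linarith

/-- **Row CF-7b at rung A-PS (PROVED composition, kernel): for ONE `e ≥ 19`, fixed-`e` Fermat–Vojta
⟹ POLY-SZPIRO(E) for every `E > 6e/(e−18)`** — `abcWithExponent_of_vojtaFermat` (exponent
`Λ = e/(e−3)`, `1 ≤ Λ < 6/5` iff `e ≥ 19` by `vojtaFermat_exponent_lt_six_fifths_iff`) composed with the
sheet's `polySzpiroWith_of_abcWithExponent` (`TransferSheetSixFifths.lean`, referee B / abc-an), the
threshold rewritten by `vojtaFermat_szpiro_exponent` (`6Λ/(6−5Λ) = 6e/(e−18)`). «NOT abc —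
POLY-SZPIRO(E), E > 6e/(e−18) stated» (`e = 19`: `E > 114`); EFFECTIVE iff the hypothesis' constant is.
[folklore] -/
theorem polySzpiroWith_of_vojtaFermat {e : ℕ} (he : 19 ≤ e)
    (h : ∀ ε' : ℝ, 0 < ε' → VojtaFermat e (e ^ 3) ε') {E : ℝ}
    (hE : 6 * (e : ℝ) / ((e : ℝ) - 18) < E) : PolySzpiroWith E := by
  have he4 : 4 ≤ e := by omega
  have hΛ : (e : ℝ) / ((e : ℝ) - 3) < 6 / 5 :=
    (vojtaFermat_exponent_lt_six_fifths_iff he4).mpr (by omega)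
  have he3 : (e : ℝ) ≠ 3 := by exact_mod_cast (show e ≠ 3 by omega)
  have he18 : (e : ℝ) ≠ 18 := by exact_mod_cast (show e ≠ 18 by omega)
  have hE' : 6 * ((e : ℝ) / ((e : ℝ) - 3)) / (6 - 5 * ((e : ℝ) / ((e : ℝ) - 3))) < E := by
    rw [vojtaFermat_szpiro_exponent he3 he18]
    exact hE
  exact polySzpiroWith_of_abcWithExponent (one_le_vojtaFermat_exponent he4) hΛ hE'
    (abcWithExponent_of_vojtaFermat he4 h)

/-- **Row CF-7b at rung A-PS BY NAME (PROVED composition): for ONE `e ≥ 19`, fixed-`e` Fermat–Vojta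
⟹ `Summit.ABC.PolySzpiroRat`** (with `K = 6e/(e−18) + 1`, through the sheet's
`polySzpiroRat_of_polySzpiroWith`). A-PS is NOT abc — «NOT abc — POLY-SZPIRO(E)» (D-0139); the
hypothesis `GenEll.VojtaFermat e (e³) ε'` (all `ε' > 0`) is OPEN and sits, in print, below UNIFORM abc
in degree `≤ e³` — a genuine intermediate rung (REF-B v0.8), not a restatement; abc itself is the
`∀ e` envelope (`abc_of_vojtaFermat_all`). [folklore] -/
theorem polySzpiroRat_of_vojtaFermat {e : ℕ} (he : 19 ≤ e)
    (h : ∀ ε' : ℝ, 0 < ε' → VojtaFermat e (e ^ 3) ε') : Summit.ABC.PolySzpiroRat :=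
  polySzpiroRat_of_polySzpiroWith
    (polySzpiroWith_of_vojtaFermat he h (E := 6 * (e : ℝ) / ((e : ℝ) - 18) + 1) (lt_add_one _))

end Summit.ABC.FunctionField

end
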